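import Mathlib.Data.Real.Basic
import Mathlib.Algebra.BigOperators.Fin
import Mathlib.Algebra.Order.BigOperators.Ring.Finset
import Mathlib.Data.Fin.VecNotation
import Mathlib.Tactic
import HarnessLib

/-!
# `NoHeavyLowerTail` (crux stmt-CriticalPhenomena-4575) — hull-port kernel, Setting B: the cell functionals

Support file (certificate seat `prim-cert-2`; `--supports stmt-CriticalPhenomena-4575`; file name assigned by the crux
lead, LEAD-GEN4 §2).  This is the measure-free vocabulary of the TWO-SIDED HULL-PORT KERNEL in the minimal five-terminal
setting ("Setting B" of the hub study `run/shared/lean/ttrl/hpk/README.md`, request `hullport-kernel-wf3lp` of prover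
`prim-hp-3`, memo `HULLPORT-REF.md` §3/§6); the certificate and the theorem `HullPortKernel.settingB_levelThree` are in
`…HullPortKernelB3.lean`.

SETTING.  Five terminals `0 = q` (the witness relay) and the ports `1, 2, 3, 4`; all five are relays.  An environment
`K` induces a partition of the terminals (its connection classes); we call it a CELL and encode it by a block labelling
`ℓ : Fin 5 → Fin 5` (`x, y` joined iff `ℓ x = ℓ y`; only the induced relation `relOf ℓ` is ever used).  Two Steiner
stars carry the coins: `u₁ ~ 1, 2` with coins `a₁, a₂` and `u₂ ~ 3, 4` with coins `b₃, b₄`.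
* The OBSERVER `s` is the glued pair `{u₁, u₂}`: in `G = K + s` it is joined to the port set `Y ⊆ {1,2,3,4}` with
  probability `P_c(Y) = Π_{t ∈ Y} c_t Π_{t ∉ Y} (1 − c_t)`, `c = (a₁, a₂, b₃, b₄)`.
* The REFERENCE graph is `R = K + e₁₂ + e₃₄` with independent extra edges `12` of weight `α = a₁a₂` and `34` of weight
  `β = b₃b₄` (the series law of the two stars).
* Level `j`: a vertex is LIGHT if its cluster contains at most `j` terminals (itself included); the observer is BAD if it
  is joined to at least one terminal and its cluster contains at most `j` terminals.

CELL FUNCTIONALS (exactly the functionals `F`, `D_t` of the hub study, cross-validated there against `prim-hp-3`'s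
partition-law engine, hpk README §1):
* `F j ℓ a₁ a₂ b₃ b₄ = Σ_Y P_c(Y) · (1[q light in K + s] − 1[s bad])` — so that for the law `p` of the cell of `K`,
  `Σ_cells p · F = I_G(q) − bad_G(s)`;
* `D j ℓ t a₁ a₂ b₃ b₄ = Σ_{e₁,e₂} α^{e₁}(1−α)^{1−e₁} β^{e₂}(1−β)^{1−e₂} · (1[q light in R] − 1[port t light in R])` — so that
  `Σ_cells p · D_t = I_R(q) − I_R(t)` (the DOMINATION hypotheses are `D_t ≥ 0`);
* `K t` — the cleared natural multipliers `κ_t · (1 − a₁a₂)(1 − b₃b₄)`, `κ_t = P_c(Y = {t}) / (1 − w_{e(t)})` (hpk §2–3).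

Also here: the scaled tensor-Bernstein forms `ev2`, `ev4` (basis `tⁱ(1−t)³⁻ⁱ` per coin) with their linearity and
positivity, and the 52 canonical cells (`cells`, least-element labellings) with `canon ℓ ∈ cells` and
`relOf (canon ℓ) = relOf ℓ`, so that cellwise statements can be checked on 52 labellings and transported to all.
No probability, no graphs: the transfer to bond percolation (`…HullPortKernelTransfer.lean`) is `prim-hp-3`'s.
-/

namespace Summit.CriticalPhenomena.PercolationContinuityZ3.Theorems.HullPortKernel.SettingB

open Finset

/-! ## Cells -/

/-- A block labelling of the five terminals `0 = q, 1, 2, 3, 4`: `x, y` lie in the same block iff `ℓ x = ℓ y`.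
[this work] -/
abbrev Lab : Type := Fin 5 → Fin 5

/-- A Boolean relation matrix on the five terminals. [this work] -/
abbrev Rel : Type := Fin 5 → Fin 5 → Bool

/-- The block relation of a labelling. [this work] -/
def relOf (ℓ : Lab) : Rel := fun x y => decide (ℓ x = ℓ y)

/-- Number of terminals in the block of `x`. [this work] -/
def blockSize (R : Rel) (x : Fin 5) : ℕ := (univ.filter fun v => R x v = true).card

/-- The block of `v` meets the port set `Y = {t : y_t}` (ports `1,2,3,4` ↔ `y₁,y₂,y₃,y₄`). [this work] -/
def meetsY (R : Rel) (y₁ y₂ y₃ y₄ : Bool) (v : Fin 5) : Bool :=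
  (y₁ && R v 1) || (y₂ && R v 2) || (y₃ && R v 3) || (y₄ && R v 4)

/-- Number of terminals whose block meets `Y` (the size of the union of the blocks meeting `Y`, i.e. the number of
terminals in the observer's cluster when the observer is joined exactly to `Y ≠ ∅`). [this work] -/
def unionSize (R : Rel) (y₁ y₂ y₃ y₄ : Bool) : ℕ :=
  (univ.filter fun v => meetsY R y₁ y₂ y₃ y₄ v = true).card

/-- The `F`-datum of a cell in the star state `Y`: `1[q light in K + s] − 1[s bad]` at level `j`
(`q`'s cluster absorbs all blocks meeting `Y` when its own block meets `Y`). [this work] -/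
def gcore (j : ℕ) (R : Rel) (y₁ y₂ y₃ y₄ : Bool) : ℤ :=
  (if (bif meetsY R y₁ y₂ y₃ y₄ 0 then decide (unionSize R y₁ y₂ y₃ y₄ ≤ j)
      else decide (blockSize R 0 ≤ j)) = true then 1 else 0) -
  (if ((y₁ || y₂ || y₃ || y₄) && decide (unionSize R y₁ y₂ y₃ y₄ ≤ j)) = true then 1 else 0)

/-- Merging the blocks of `u` and `v` (an open extra edge `uv`). [this work] -/
def mergeR (R : Rel) (u v : Fin 5) : Rel :=
  fun x y => R x y || ((R x u || R x v) && (R y u || R y v))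

/-- The `D_t`-datum of a cell in the extra-edge state `(e₁, e₂)` of `R = K + e₁₂ + e₃₄`:
`1[q light] − 1[port t light]` at level `j` (`t : Fin 4` is the port `t + 1`). [this work] -/
def hcore (j : ℕ) (R : Rel) (t : Fin 4) (e₁ e₂ : Bool) : ℤ :=
  let R₁ := bif e₁ then mergeR R 1 2 else R
  let R₂ := bif e₂ then mergeR R₁ 3 4 else R₁
  (if blockSize R₂ 0 ≤ j then 1 else 0) - (if blockSize R₂ t.succ ≤ j then 1 else 0)

/-- `F`-data of the cell `ℓ`. [this work] -/
def gval (j : ℕ) (ℓ : Lab) (y₁ y₂ y₃ y₄ : Bool) : ℤ := gcore j (relOf ℓ) y₁ y₂ y₃ y₄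

/-- `D`-data of the cell `ℓ`. [this work] -/
def hval (j : ℕ) (ℓ : Lab) (t : Fin 4) (e₁ e₂ : Bool) : ℤ := hcore j (relOf ℓ) t e₁ e₂

/-! ## The cell functionals -/

/-- `t` if `b`, else `1 − t` (one Bernoulli factor). [this work] -/
def pick (t : ℝ) (b : Bool) : ℝ := bif b then t else 1 - t

/-- `pick` is nonnegative for `t ∈ [0,1]`. [folklore] -/
theorem pick_nonneg {t : ℝ} (h0 : 0 ≤ t) (h1 : t ≤ 1) (b : Bool) : 0 ≤ pick t b := by
  cases b
  · exact sub_nonneg.2 h1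
  · exact h0

/-- The cell functional `F = Σ_Y P_c(Y) (1[q light in K + s] − 1[s bad])` at level `j`, coins `a₁ a₂ b₃ b₄` on the
ports `1 2 3 4`. [this work] -/
def F (j : ℕ) (ℓ : Lab) (a₁ a₂ b₃ b₄ : ℝ) : ℝ :=
  ∑ y₁ : Bool, ∑ y₂ : Bool, ∑ y₃ : Bool, ∑ y₄ : Bool,
    (gval j ℓ y₁ y₂ y₃ y₄ : ℝ) * (pick a₁ y₁ * pick a₂ y₂ * pick b₃ y₃ * pick b₄ y₄)

/-- The cell functional `D_t = Σ_{e₁,e₂} α^{e₁}(1−α)^{1−e₁} β^{e₂}(1−β)^{1−e₂} (1[q light in R] − 1[port t light in R])`,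
`α = a₁a₂`, `β = b₃b₄`, at level `j`. [this work] -/
def D (j : ℕ) (ℓ : Lab) (t : Fin 4) (a₁ a₂ b₃ b₄ : ℝ) : ℝ :=
  ∑ e₁ : Bool, ∑ e₂ : Bool, (hval j ℓ t e₁ e₂ : ℝ) * (pick (a₁ * a₂) e₁ * pick (b₃ * b₄) e₂)

/-- The cleared natural multipliers `K_t = κ_t (1 − a₁a₂)(1 − b₃b₄)`, `κ_t = P_c(Y = {t}) / (1 − w_{e(t)})`:
`K₁ = a₁(1−a₂)(1−b₃)(1−b₄)(1−b₃b₄)`, `K₂ = (1−a₁)a₂(1−b₃)(1−b₄)(1−b₃b₄)`, `K₃ = (1−a₁)(1−a₂)(1−a₁a₂)b₃(1−b₄)`,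
`K₄ = (1−a₁)(1−a₂)(1−a₁a₂)(1−b₃)b₄` (hpk README §2–3). [this work] -/
def K (t : Fin 4) (a₁ a₂ b₃ b₄ : ℝ) : ℝ :=
  if t = 0 then a₁ * (1 - a₂) * ((1 - b₃) * (1 - b₄) * (1 - b₃ * b₄))
  else if t = 1 then (1 - a₁) * a₂ * ((1 - b₃) * (1 - b₄) * (1 - b₃ * b₄))
  else if t = 2 then (1 - a₁) * (1 - a₂) * (1 - a₁ * a₂) * (b₃ * (1 - b₄))
  else (1 - a₁) * (1 - a₂) * (1 - a₁ * a₂) * ((1 - b₃) * b₄)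

/-- The multipliers are nonnegative on the coin cube. [this work] -/
theorem K_nonneg (t : Fin 4) {a₁ a₂ b₃ b₄ : ℝ} (ha₁ : 0 ≤ a₁) (ha₁' : a₁ ≤ 1) (ha₂ : 0 ≤ a₂) (ha₂' : a₂ ≤ 1)
    (hb₃ : 0 ≤ b₃) (hb₃' : b₃ ≤ 1) (hb₄ : 0 ≤ b₄) (hb₄' : b₄ ≤ 1) : 0 ≤ K t a₁ a₂ b₃ b₄ := by
  have h12 : 0 ≤ 1 - a₁ * a₂ := by nlinarith
  have h34 : 0 ≤ 1 - b₃ * b₄ := by nlinarith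
  have ha₁'' := sub_nonneg.2 ha₁'
  have ha₂'' := sub_nonneg.2 ha₂'
  have hb₃'' := sub_nonneg.2 hb₃'
  have hb₄'' := sub_nonneg.2 hb₄'
  unfold K
  split_ifs <;> positivity

/-! ## Invariance under relabelling -/

/-- Two labellings of the same partition have the same relation matrix. [this work] -/
theorem relOf_eq_of_iff {ℓ ℓ' : Lab} (h : ∀ x y, ℓ x = ℓ y ↔ ℓ' x = ℓ' y) : relOf ℓ = relOf ℓ' := by
  funext x y
  exact (decide_eq_decide.2 (h x y))

/-- `F` depends on the cell only through its partition. [this work] -/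
theorem F_congr (j : ℕ) {ℓ ℓ' : Lab} (h : ∀ x y, ℓ x = ℓ y ↔ ℓ' x = ℓ' y) (a₁ a₂ b₃ b₄ : ℝ) :
    F j ℓ a₁ a₂ b₃ b₄ = F j ℓ' a₁ a₂ b₃ b₄ := by
  simp only [F, gval, relOf_eq_of_iff h]

/-- `D_t` depends on the cell only through its partition. [this work] -/
theorem D_congr (j : ℕ) {ℓ ℓ' : Lab} (h : ∀ x y, ℓ x = ℓ y ↔ ℓ' x = ℓ' y) (t : Fin 4) (a₁ a₂ b₃ b₄ : ℝ) :
    D j ℓ t a₁ a₂ b₃ b₄ = D j ℓ' t a₁ a₂ b₃ b₄ := by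
  simp only [D, hval, relOf_eq_of_iff h]

/-! ## Scaled Bernstein forms -/

/-- The scaled Bernstein basis of degree 3: `bern t i = tⁱ (1 − t)³⁻ⁱ`. [folklore] -/
def bern (t : ℝ) (i : Fin 4) : ℝ := t ^ (i : ℕ) * (1 - t) ^ (3 - (i : ℕ))

/-- `bern t i ≥ 0` for `t ∈ [0,1]`. [folklore] -/
theorem bern_nonneg {t : ℝ} (h0 : 0 ≤ t) (h1 : t ≤ 1) (i : Fin 4) : 0 ≤ bern t i :=
  mul_nonneg (pow_nonneg h0 _) (pow_nonneg (sub_nonneg.2 h1) _)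

/-- A bivariate integer table of bidegree `(3,3)` in the scaled Bernstein basis. [this work] -/
abbrev Tab : Type := Fin 4 → Fin 4 → ℤ

/-- A four-variate integer table of multidegree `(3,3,3,3)` in the scaled Bernstein basis. [this work] -/
abbrev Tab4 : Type := Fin 4 → Fin 4 → Fin 4 → Fin 4 → ℤ

/-- The bivariate form of a table: `Σ_{i,j} u i j · bern x i · bern y j`. [this work] -/
def ev2 (u : Tab) (x y : ℝ) : ℝ := ∑ i, ∑ j, (u i j : ℝ) * (bern x i * bern y j)

/-- The four-variate form of a table in the coins `a₁ a₂ b₃ b₄`. [this work] -/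
def ev4 (W : Tab4) (a₁ a₂ b₃ b₄ : ℝ) : ℝ :=
  ∑ i, ∑ j, ∑ k, ∑ l, (W i j k l : ℝ) * ((bern a₁ i * bern a₂ j) * (bern b₃ k * bern b₄ l))

/-- The outer product of two bivariate tables. [this work] -/
def outer (u v : Tab) : Tab4 := fun i j k l => u i j * v k l

/-- The form of an outer product is the product of the forms. [this work] -/
theorem ev4_outer (u v : Tab) (a₁ a₂ b₃ b₄ : ℝ) :
    ev4 (outer u v) a₁ a₂ b₃ b₄ = ev2 u a₁ a₂ * ev2 v b₃ b₄ := by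
  unfold ev4 ev2 outer
  rw [Finset.sum_mul_sum]
  refine Finset.sum_congr rfl fun i _ => ?_
  simp_rw [Finset.sum_mul_sum]
  rw [Finset.sum_comm]
  refine Finset.sum_congr rfl fun k _ => Finset.sum_congr rfl fun j _ => Finset.sum_congr rfl fun l _ => ?_
  push_cast
  ring

/-- `ev4` is additive in the table. [this work] -/
theorem ev4_add (W W' : Tab4) (a₁ a₂ b₃ b₄ : ℝ) :
    ev4 (W + W') a₁ a₂ b₃ b₄ = ev4 W a₁ a₂ b₃ b₄ + ev4 W' a₁ a₂ b₃ b₄ := by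
  unfold ev4
  simp only [Pi.add_apply, Int.cast_add, add_mul, Finset.sum_add_distrib]

/-- `ev4 (W − W') = ev4 W − ev4 W'`. [this work] -/
theorem ev4_sub (W W' : Tab4) (a₁ a₂ b₃ b₄ : ℝ) :
    ev4 (W - W') a₁ a₂ b₃ b₄ = ev4 W a₁ a₂ b₃ b₄ - ev4 W' a₁ a₂ b₃ b₄ := by
  unfold ev4
  simp only [Pi.sub_apply, Int.cast_sub, sub_mul, Finset.sum_sub_distrib]

/-- `ev4 (c • W) = c · ev4 W`. [this work] -/
theorem ev4_zsmul (c : ℤ) (W : Tab4) (a₁ a₂ b₃ b₄ : ℝ) :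
    ev4 (c • W) a₁ a₂ b₃ b₄ = c * ev4 W a₁ a₂ b₃ b₄ := by
  unfold ev4
  simp only [Pi.smul_apply, smul_eq_mul, Int.cast_mul, mul_assoc, Finset.mul_sum]

/-- `ev4` of a finite sum of tables. [this work] -/
theorem ev4_sum {ι : Type*} (s : Finset ι) (W : ι → Tab4) (a₁ a₂ b₃ b₄ : ℝ) :
    ev4 (∑ y ∈ s, W y) a₁ a₂ b₃ b₄ = ∑ y ∈ s, ev4 (W y) a₁ a₂ b₃ b₄ := by
  induction s using Finset.cons_induction with
  | empty =>
    simp only [Finset.sum_empty]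
    unfold ev4
    simp
  | cons a s ha ih => rw [Finset.sum_cons, Finset.sum_cons, ev4_add, ih]

/-- A table with nonnegative entries has a nonnegative form on the coin cube. [folklore] -/
theorem ev4_nonneg (W : Tab4) (hW : ∀ i j k l, 0 ≤ W i j k l) {a₁ a₂ b₃ b₄ : ℝ} (ha₁ : 0 ≤ a₁) (ha₁' : a₁ ≤ 1)
    (ha₂ : 0 ≤ a₂) (ha₂' : a₂ ≤ 1) (hb₃ : 0 ≤ b₃) (hb₃' : b₃ ≤ 1) (hb₄ : 0 ≤ b₄) (hb₄' : b₄ ≤ 1) :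
    0 ≤ ev4 W a₁ a₂ b₃ b₄ := by
  unfold ev4
  refine Finset.sum_nonneg fun i _ => Finset.sum_nonneg fun j _ =>
    Finset.sum_nonneg fun k _ => Finset.sum_nonneg fun l _ => ?_
  exact mul_nonneg (by exact_mod_cast hW i j k l)
    (mul_nonneg (mul_nonneg (bern_nonneg ha₁ ha₁' i) (bern_nonneg ha₂ ha₂' j))
      (mul_nonneg (bern_nonneg hb₃ hb₃' k) (bern_nonneg hb₄ hb₄' l)))

/-! ## The 52 canonical cells -/

/-- The canonical labelling of a partition: every terminal is labelled by the least terminal of its block. [this work] -/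
def canon (ℓ : Lab) : Lab := fun x => (univ.filter fun y => ℓ y = ℓ x).min' ⟨x, by simp⟩

/-- The canonical label of `x` lies in the block of `x`. [this work] -/
theorem apply_canon (ℓ : Lab) (x : Fin 5) : ℓ (canon ℓ x) = ℓ x := by
  have h := Finset.min'_mem (univ.filter fun y => ℓ y = ℓ x) ⟨x, by simp⟩
  exact (Finset.mem_filter.1 h).2

/-- `canon ℓ` labels the same partition as `ℓ`. [this work] -/
theorem canon_eq_iff (ℓ : Lab) (x y : Fin 5) : canon ℓ x = canon ℓ y ↔ ℓ x = ℓ y := by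
  constructor
  · intro h
    rw [← apply_canon ℓ x, ← apply_canon ℓ y, h]
  · intro h
    unfold canon
    congr 1
    ext z
    simp [h]

/-- `relOf (canon ℓ) = relOf ℓ`. [this work] -/
theorem relOf_canon (ℓ : Lab) : relOf (canon ℓ) = relOf ℓ :=
  relOf_eq_of_iff fun x y => canon_eq_iff ℓ x y

/-- The canonical label is at most the terminal. [this work] -/
theorem canon_le (ℓ : Lab) (x : Fin 5) : canon ℓ x ≤ x :=
  Finset.min'_le _ _ (by simp)

/-- `canon` is idempotent. [this work] -/
theorem canon_canon (ℓ : Lab) (x : Fin 5) : canon ℓ (canon ℓ x) = canon ℓ x :=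
  (canon_eq_iff ℓ _ _).2 (apply_canon ℓ x)

/-- The 52 canonical cells (= set partitions of the five terminals, as least-element labellings). [this work] -/
def cells : List Lab :=
  [![0, 0, 0, 0, 0], ![0, 0, 0, 0, 4], ![0, 0, 0, 3, 0], ![0, 0, 0, 3, 3], ![0, 0, 0, 3, 4], ![0, 0, 2, 0, 0],
    ![0, 0, 2, 0, 2], ![0, 0, 2, 0, 4], ![0, 0, 2, 2, 0], ![0, 0, 2, 2, 2], ![0, 0, 2, 2, 4], ![0, 0, 2, 3, 0],
    ![0, 0, 2, 3, 2], ![0, 0, 2, 3, 3], ![0, 0, 2, 3, 4], ![0, 1, 0, 0, 0], ![0, 1, 0, 0, 1], ![0, 1, 0, 0, 4],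
    ![0, 1, 0, 1, 0], ![0, 1, 0, 1, 1], ![0, 1, 0, 1, 4], ![0, 1, 0, 3, 0], ![0, 1, 0, 3, 1], ![0, 1, 0, 3, 3],
    ![0, 1, 0, 3, 4], ![0, 1, 1, 0, 0], ![0, 1, 1, 0, 1], ![0, 1, 1, 0, 4], ![0, 1, 1, 1, 0], ![0, 1, 1, 1, 1],
    ![0, 1, 1, 1, 4], ![0, 1, 1, 3, 0], ![0, 1, 1, 3, 1], ![0, 1, 1, 3, 3], ![0, 1, 1, 3, 4], ![0, 1, 2, 0, 0],
    ![0, 1, 2, 0, 1], ![0, 1, 2, 0, 2], ![0, 1, 2, 0, 4], ![0, 1, 2, 1, 0], ![0, 1, 2, 1, 1], ![0, 1, 2, 1, 2],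
    ![0, 1, 2, 1, 4], ![0, 1, 2, 2, 0], ![0, 1, 2, 2, 1], ![0, 1, 2, 2, 2], ![0, 1, 2, 2, 4], ![0, 1, 2, 3, 0],
    ![0, 1, 2, 3, 1], ![0, 1, 2, 3, 2], ![0, 1, 2, 3, 3], ![0, 1, 2, 3, 4]]

/-- Every idempotent, deflationary labelling is one of the 52 canonical cells (exhaustion over `5^5` labellings).
[this work] -/
theorem mem_cells_of_minimal : ∀ p₀ p₁ p₂ p₃ p₄ : Fin 5,
    (∀ x : Fin 5, (![p₀, p₁, p₂, p₃, p₄] : Lab) x ≤ x) →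
    (∀ x : Fin 5, (![p₀, p₁, p₂, p₃, p₄] : Lab) ((![p₀, p₁, p₂, p₃, p₄] : Lab) x) = (![p₀, p₁, p₂, p₃, p₄] : Lab) x) →
    (![p₀, p₁, p₂, p₃, p₄] : Lab) ∈ cells := by
  decide +kernel

/-- The canonical labelling of any cell is one of the 52 canonical cells. [this work] -/
theorem canon_mem_cells (ℓ : Lab) : canon ℓ ∈ cells := by
  have e : canon ℓ = ![canon ℓ 0, canon ℓ 1, canon ℓ 2, canon ℓ 3, canon ℓ 4] := by
    funext x
    fin_cases x <;> rfl
  rw [e]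
  refine mem_cells_of_minimal _ _ _ _ _ ?_ ?_
  · intro x; rw [← e]; exact canon_le ℓ x
  · intro x; rw [← e]; exact canon_canon ℓ x

/-- **Reduction to the canonical cells**: a property of labellings that depends only on the partition holds for every
labelling as soon as it holds for the 52 canonical ones. [this work] -/
theorem forall_of_forall_cells {P : Lab → Prop} (hP : ∀ ℓ ℓ' : Lab, relOf ℓ = relOf ℓ' → P ℓ → P ℓ')
    (h : ∀ ℓ ∈ cells, P ℓ) (ℓ : Lab) : P ℓ :=
  hP (canon ℓ) ℓ (relOf_canon ℓ) (h _ (canon_mem_cells ℓ))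

end Summit.CriticalPhenomena.PercolationContinuityZ3.Theorems.HullPortKernel.SettingB
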